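import Mathlib
import Literature.RepresentationTheory.FiniteGroups.KLRGradedCellularBasis

/-!
# DEV rungs — kernel-checked STATEMENTS of the deterministic one-step inputs of (Q) (lead c7, line `klr-graded-polynomial-method`)

Crux stmt-MatrixMultiplication-8302 `SnSubsetDichotomy.NoThresholdSubsetTriple`; report
`Cruxes/NoThresholdSubsetTriple/Lines/klr_graded_polynomial_method-lead-c7.md` §2a and appendix A.

This file FILES NOTHING (a crux workfile; `sorry` allowed): it fixes, in tree vocabulary, the statements a future DEV line would
register as stubs.  Everything is stated for an arbitrary finite lower set `ν ⊆ ℕ × ℕ` (a Young diagram given by its cells), with the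
Plancherel transition probability of an addable node given by its HOOK-PRODUCT formula (so no `Nat.Partition (n+1)` has to be
built); `transProb_sum` records that these probabilities sum to `1` (up-branching rule / hook walk — equivalent, given the tree's
hook length formula `numStandardTableaux_mul_prod_hookLength_holds`, to `Σ_{λ = ν + □} f^λ = (|ν|+1)·f^ν`).

* `massFactor`      — (F3) of app. A: filling the corner `z` multiplies the transition probability of every other corner `y` by the exact
                      factor `1 + 1/(h(h+2))`, `h = |row y − row z| + |col y − col z| − 1`.                         [proved on paper; checked to 1e−15]
* `transProb_sum`   — `Σ_y p_y = 1`.                                                                                  [classical]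
* `sq_change_le`    — (L2′): `|q(ν ∪ z) − q(ν)| ≤ 6·√q(ν) + 11/3` for every corner `z`.                              [proved on paper, app. A]
* `condVar_le`      — (L3):  `Σ_z p_z (q(ν∪z) − q(ν))² ≤ 72·q(ν) + 32`.                                              [corollary of (L2′)]
* `drift_pointwise` — (L1) in the pointwise form `E[Δq | ν] ≤ K − c·q/√n` on the 3√n-box: TRUE for every shape probed (exhaustive n ≤ 30,
                      sampled n ≤ 6400) but expected FALSE asymptotically (thin aligned tails) — recorded as the statement NOT to file; the
                      statement to prove is (L1*) for the renormalised energy `V` of the report, whose Lean definition needs the smoothed local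
                      transition density and is left to the DEV planner.
-/

set_option linter.dupNamespace false

noncomputable section

open scoped BigOperators

namespace Summit.MatrixMultiplication.MatrixMultiplication.Cruxes.NoThresholdSubsetTriple.DevRungs

open Literature.RepresentationTheory.FiniteGroups (addableNodes)

/-- Row length of row `i` of the cell set `ν`. -/
def rowLen (ν : Finset (ℕ × ℕ)) (i : ℕ) : ℕ := (ν.filter fun c => c.1 = i).card

/-- Column length of column `j` of the cell set `ν`. -/
def colLen (ν : Finset (ℕ × ℕ)) (j : ℕ) : ℕ := (ν.filter fun c => c.2 = j).card

/-- Hook length of the cell `(i, j)` in `ν` (junk off the diagram). -/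
def hook (ν : Finset (ℕ × ℕ)) (c : ℕ × ℕ) : ℕ := (rowLen ν c.1 - c.2) + (colLen ν c.2 - c.1) - 1

/-- Plancherel transition probability of the addable node `y = (r, c)` of `ν`, in hook-product form:
`p_y = ∏_{j < c} h(r,j)/(h(r,j)+1) · ∏_{i < r} h(i,c)/(h(i,c)+1)` (`= f^{ν ∪ y} / ((|ν|+1) f^ν)` by the hook length formula). -/
def transProb (ν : Finset (ℕ × ℕ)) (y : ℕ × ℕ) : ℝ :=
  (∏ j ∈ Finset.range y.2, ((hook ν (y.1, j) : ℝ) / (hook ν (y.1, j) + 1))) *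
    ∏ i ∈ Finset.range y.1, ((hook ν (i, y.2) : ℝ) / (hook ν (i, y.2) + 1))

/-- Row-parity charge `χ_i = (−1)^i · [row i has odd length]`. -/
def rowCharge (ν : Finset (ℕ × ℕ)) (i : ℕ) : ℤ := if Odd (rowLen ν i) then (-1) ^ i else 0

/-- Column-parity charge `χ^c_j = (−1)^j · [column j has odd length]`. -/
def colCharge (ν : Finset (ℕ × ℕ)) (j : ℕ) : ℤ := if Odd (colLen ν j) then (-1) ^ j else 0

/-- Charge strictly below row `r`: `R(r) = Σ_{i > r} χ_i` (rows `≤ |ν|` suffice: longer indices carry empty rows). -/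
def chargeBelow (ν : Finset (ℕ × ℕ)) (r : ℕ) : ℤ :=
  ∑ i ∈ (Finset.range (ν.card + 1)).filter (fun i => r < i), rowCharge ν i

/-- Charge strictly right of column `c`: `C(c) = Σ_{j > c} χ^c_j`. -/
def chargeRight (ν : Finset (ℕ × ℕ)) (c : ℕ) : ℤ :=
  ∑ j ∈ (Finset.range (ν.card + 1)).filter (fun j => c < j), colCharge ν j

/-- The J-increment seen from the addable node `y`: `x_y = R(row y) − C(col y)` (so `ΔJ = π_y · x_y` when `y` is filled;
tree: `stub_pairDiff_eq_chargeSum`). -/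
def incr (ν : Finset (ℕ × ℕ)) (y : ℕ × ℕ) : ℤ := chargeBelow ν y.1 - chargeRight ν y.2

/-- Conditional second moment of the J-increment: `q(ν) = Σ_{y addable} p_y x_y²`. -/
def sqEnergy (ν : Finset (ℕ × ℕ)) : ℝ := ∑ y ∈ addableNodes ν, transProb ν y * ((incr ν y : ℝ) ^ 2)

/-- `ν` is (the cell set of) a Young diagram. -/
def IsDiagram (ν : Finset (ℕ × ℕ)) : Prop := IsLowerSet (ν : Set (ℕ × ℕ))

/-- (F3) EXACT MASS FACTOR.  Filling the addable node `z` multiplies the transition probability of every other addable node `y`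
by `1 + 1/(h(h+2))`, `h = |row y − row z| + |col y − col z| − 1 ≥ 1` (exactly one hook of the product for `p_y` grows by one).
[lead c7 report app. A (F3); checked numerically to 1e−15 on 24 904 pairs] -/
theorem massFactor {ν : Finset (ℕ × ℕ)} (hν : IsDiagram ν) {y z : ℕ × ℕ} (hy : y ∈ addableNodes ν)
    (hz : z ∈ addableNodes ν) (hyz : y ≠ z) :
    transProb (insert z ν) y =
      transProb ν y * (1 + 1 / (((Int.natAbs ((y.1 : ℤ) - z.1) + Int.natAbs ((y.2 : ℤ) - z.2) - 1 : ℕ) : ℝ) *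
        ((Int.natAbs ((y.1 : ℤ) - z.1) + Int.natAbs ((y.2 : ℤ) - z.2) - 1 : ℕ) + 2))) := by
  sorry

/-- UP-BRANCHING / HOOK WALK: the transition probabilities of a diagram sum to one. [Greene–Nijenhuis–Wilf 1979, Thm.; equivalently
`Σ_{λ = ν+□} f^λ = (|ν|+1) f^ν` with the hook length formula] -/
theorem transProb_sum {ν : Finset (ℕ × ℕ)} (hν : IsDiagram ν) : ∑ y ∈ addableNodes ν, transProb ν y = 1 := by
  sorry

/-- (L2′) SQUARE-ROOT INCREMENT BOUND: for every diagram and every addable node `z`,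
`|q(ν ∪ z) − q(ν)| ≤ 6·√q(ν) + 11/3`. [lead c7 report app. A] -/
theorem sq_change_le {ν : Finset (ℕ × ℕ)} (hν : IsDiagram ν) {z : ℕ × ℕ} (hz : z ∈ addableNodes ν) :
    |sqEnergy (insert z ν) - sqEnergy ν| ≤ 6 * Real.sqrt (sqEnergy ν) + 11 / 3 := by
  sorry

/-- (L3) CONDITIONAL VARIANCE BOUND: `Σ_z p_z (q(ν∪z) − q(ν))² ≤ 72·q(ν) + 32` (from (L2′) and `Σ_z p_z = 1`). [lead c7 report app. A] -/
theorem condVar_le {ν : Finset (ℕ × ℕ)} (hν : IsDiagram ν) :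
    ∑ z ∈ addableNodes ν, transProb ν z * (sqEnergy (insert z ν) - sqEnergy ν) ^ 2 ≤ 72 * sqEnergy ν + 32 := by
  sorry

/-- (L1) POINTWISE RESTORING DRIFT on the 3√n-box — the form that holds for every shape probed (exhaustive n ≤ 30: sup 1.61 with c = 1;
sampled families n ≤ 6400) but is expected to FAIL asymptotically for thin parity-aligned tails (rate ∝ k/n); recorded so that nobody files it.
The statement to prove is the (L1*) analogue for the renormalised energy `V` of the report. [lead c7 report §2a caveat] -/
def driftPointwise (K c : ℝ) : Prop :=
  ∀ (n : ℕ) (ν : Finset (ℕ × ℕ)), IsDiagram ν → ν.card ≤ n → (∀ x ∈ ν, (x.1 : ℝ) < 3 * Real.sqrt n ∧ (x.2 : ℝ) < 3 * Real.sqrt n) →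
    ∑ z ∈ addableNodes ν, transProb ν z * (sqEnergy (insert z ν) - sqEnergy ν) ≤ K - c * sqEnergy ν / Real.sqrt n

/-- THE (Q)-LEMMA's deterministic hypotheses packaged (what a DEV line registers): (L1*)-for-some-Lyapunov-V ∧ (L2) ∧ (L3). -/
def lyapunovInputs : Prop :=
  ∃ (V : Finset (ℕ × ℕ) → ℝ) (C₀ K c b C : ℝ), 0 < C₀ ∧ 0 < c ∧
    (∀ ν, IsDiagram ν → sqEnergy ν ≤ C₀ * V ν ∧ 0 ≤ V ν) ∧ V ∅ = 0 ∧
    ∀ (n : ℕ) (ν : Finset (ℕ × ℕ)), IsDiagram ν → ν.card ≤ n →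
      (∀ x ∈ ν, (x.1 : ℝ) < 3 * Real.sqrt n ∧ (x.2 : ℝ) < 3 * Real.sqrt n) →
        (∑ z ∈ addableNodes ν, transProb ν z * (V (insert z ν) - V ν) ≤ K - c * sqEnergy ν / Real.sqrt n) ∧
        (∀ z ∈ addableNodes ν, |V (insert z ν) - V ν| ≤ b * Real.sqrt n) ∧
        (∑ z ∈ addableNodes ν, transProb ν z * (V (insert z ν) - V ν) ^ 2 ≤ C * (sqEnergy ν + 1))

end Summit.MatrixMultiplication.MatrixMultiplication.Cruxes.NoThresholdSubsetTriple.DevRungs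

end
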